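import Summits.SmoothPoincare4.SmoothPoincare4.Theorems.CylinderEntropyCylinderRungTwoProductTestLimitBounds
import Summits.SmoothPoincare4.SmoothPoincare4.Theorems.CylinderEntropyCylinderRungTwoTiltExcessVanishing
import Literature.Geometry.Riemannian.EmbeddedSubmanifoldHausdorff
import HarnessLib

/-!
# Route `CylinderEntropy`, crux `CylinderRungTwo` (stmt-SmoothPoincare4-7631), line `killing-flux`:
# the product-test identities pass to the weak limit
# (registered helper `helper_productTestLimit`, step S2 of the area-quantization plan)

For a sequence of closed embedded cross-sections `ι_k : M⁴ → N = S⁴ × ℝ = {z ∈ ℝ⁶ | ∑_{i<5} zᵢ² = 1}`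
with smooth unit normals `ν_k` tangent to `N`, heights `|z₅| ≤ B`, Willmore-type energies
`∫ H_k² d(ι_k^* μH⁴) → 0`, areas `μH⁴(ι_k(M)) → A < ∞`, whose area measures `μH⁴⌊ι_k(M)` converge
weakly (against bounded continuous functions) to a finite measure `μ` carried by the slab
`N ∩ {|z₅| ≤ B}`, and for every `Φ ∈ C²(ℝ)`, `P ∈ C²(ℝ⁵)`:

  `∫ Φ(z₅) · [ Δ_{ℝ⁵} P(z') - D²P(z')(z', z') - 4 DP(z')(z') ] dμ(z) = 0`,   `z' = truncL z`.

Proof. By the single-slice estimate (`abs_integral_productTest_comp_le`, `…ProductTestLimitBounds.lean`)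
`|∫ F ∘ ι_k dμ_{g_k}| ≤ A₁A₂ (3 T_k + 2 √(μ_{g_k}(M) T_k) + 2 √(μ_{g_k}(M) ∫ H_k² dμ_{g_k})) → 0`: the
tilt excesses `T_k → 0` (`tendsto_lintegral_tiltExcess_comap`, `…TiltExcessVanishing.lean`),
`∫ H_k² → 0` by hypothesis and `μ_{g_k}(M) = c μH⁴(ι_k(M)) → cA < ∞` (`c • ι_k^* μH⁴ = μ_{g_k}`). On the
other hand `∫ F ∘ ι_k dμ_{g_k} = c ∫_{ι_k(M)} F dμH⁴` (`integral_comp_riemannianMeasure_induced`,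
`μHE⁴ = c • μH⁴`), and replacing the continuous `F` by its bounded continuous clamp, which agrees with
`F` on the ball `‖z‖ ≤ 1 + |B|` carrying all the measures involved, weak convergence gives
`c ∫_{ι_k(M)} F dμH⁴ → c ∫ F dμ`; uniqueness of limits and `c ≠ 0` conclude.

* `tendsto_integral_zero_of_tendsto_lintegral_zero` — `ℝ≥0∞` to real conversion of the decays;
* `productTest_limit` — the statement with implicit binders;
* `helper_productTestLimit` — the registered helper, verbatim.

Everything here is PROVED (no `sorry`, no new definitions, no named facts).

References: W. K. Allard, *On the first variation of a varifold*, Ann. of Math. 95 (1972), §6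
(first variation and weak limits); R. S. Hamilton, Comm. Anal. Geom. 1 (1993) 127–137, §4.
-/

-- the prescribed namespace `Summit.SmoothPoincare4.SmoothPoincare4.…` repeats `SmoothPoincare4`
set_option linter.dupNamespace false

noncomputable section

open Set Function Filter MeasureTheory
open scoped Manifold ContDiff ENNReal NNReal Topology BigOperators RealInnerProductSpace
  BoundedContinuousFunction

namespace Summit.SmoothPoincare4.SmoothPoincare4.Cruxes.CylinderRungTwo.KillingFlux

open Literature.Geometry.Riemannian Literature.Geometry.Lorentzian
  Literature.Geometry.Lorentzian.PseudoRiemannianMetric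
open Literature.Geometry.Riemannian.SphericalCylinderEntropy (truncL truncL_apply)

/-! ## The limit -/

section Limit

/-- **From `ℝ≥0∞` decay to real decay.** If `μ_k = c • P_k`, `0 ≤ f_k` is a.e. strongly measurable
and `∫⁻ f_k dP_k → 0`, then `∫ f_k dμ_k → 0`. [folklore] -/
theorem tendsto_integral_zero_of_tendsto_lintegral_zero {X : Type*} [MeasurableSpace X]
    {μ P : ℕ → Measure X} {c : ℝ≥0} (hμ : ∀ k, (c : ℝ≥0∞) • P k = μ k) {f : ℕ → X → ℝ}
    (hf0 : ∀ k x, 0 ≤ f k x) (hfm : ∀ k, AEStronglyMeasurable (f k) (μ k))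
    (h : Tendsto (fun k => ∫⁻ x, ENNReal.ofReal (f k x) ∂P k) atTop (𝓝 0)) :
    Tendsto (fun k => ∫ x, f k x ∂μ k) atTop (𝓝 0) := by
  have heq : ∀ k, ∫ x, f k x ∂μ k = ((c : ℝ≥0∞) * ∫⁻ x, ENNReal.ofReal (f k x) ∂P k).toReal :=
    fun k => by
      rw [integral_eq_lintegral_of_nonneg_ae (Eventually.of_forall (hf0 k)) (hfm k), ← hμ k,
        lintegral_smul_measure, smul_eq_mul]
  have h1 : Tendsto (fun k => (c : ℝ≥0∞) * ∫⁻ x, ENNReal.ofReal (f k x) ∂P k) atTop (𝓝 0) := by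
    simpa only [mul_zero] using ENNReal.Tendsto.const_mul h (Or.inr ENNReal.coe_ne_top)
  have h2 := (ENNReal.tendsto_toReal ENNReal.zero_ne_top).comp h1
  rw [ENNReal.toReal_zero] at h2
  exact (tendsto_congr heq).2 h2

variable {M : Type*} [TopologicalSpace M] [ChartedSpace (EuclideanSpace ℝ (Fin 4)) M]
  [IsManifold (𝓡 4) ∞ M] [CompactSpace M] [T2Space M] [MeasurableSpace M] [BorelSpace M]

/-- **The product-test identities pass to the weak limit.** For closed embedded cross-sections
`ι_k : M⁴ → N = S⁴ × ℝ` with smooth unit normals `ν_k` tangent to `N`, heights `|z₅| ≤ B`,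
`∫ H_k² d(ι_k^*μH⁴) → 0`, `μH⁴(ι_k(M)) → A < ∞`, and area measures converging weakly to a finite
measure `μ` carried by the slab: `∫ F dμ = 0` for
`F(z) = Φ(z₅)[Δ_{ℝ⁵}P(z') - D²P(z')(z',z') - 4DP(z')(z')]`, `Φ ∈ C²(ℝ)`, `P ∈ C²(ℝ⁵)`
(single-slice estimate `abs_integral_productTest_comp_le`, tilt-excess vanishing, the area formula
`∫ F ∘ ι_k dμ_{g_k} = c ∫_{ι_k(M)} F dμH⁴`, a bounded continuous clamp of `F`, and uniqueness of
limits). [cite: Allard1972, §6] -/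
theorem productTest_limit {ι ν : ℕ → M → EuclideanSpace ℝ (Fin 6)} (hinj : ∀ k, Injective (ι k))
    (himm : ∀ k, (euclideanMetric (EuclideanSpace ℝ (Fin 6))).IsSpacelikeImmersion (𝓡 4) (ι k))
    (hν : ∀ k, ContMDiff (𝓡 4) 𝓘(ℝ, EuclideanSpace ℝ (Fin 6)) ∞ (ν k))
    (hun : ∀ k, (euclideanMetric (EuclideanSpace ℝ (Fin 6))).IsUnitNormal (𝓡 4) (ι k) (ν k) 1)
    (hN : ∀ k x, ∑ i : Fin 5, ι k x (Fin.castSucc i) ^ 2 = 1)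
    (hνN : ∀ k x, ∑ i : Fin 5, ν k x (Fin.castSucc i) * ι k x (Fin.castSucc i) = 0)
    {B : ℝ} (hB : ∀ k x, |ι k x 5| ≤ B)
    (hW : Tendsto (fun k => ∫⁻ x, ENNReal.ofReal
        ((euclideanMetric (EuclideanSpace ℝ (Fin 6))).meanCurvature (ι k) contMDiff_pullbackBilin_holds (himm k) (ν k) x ^ 2)
        ∂(Measure.comap (ι k) (μH[4] : Measure (EuclideanSpace ℝ (Fin 6))))) atTop (𝓝 0))
    {A : ℝ≥0∞} (hA : A < ⊤) (hAr : Tendsto (fun k => μH[4] (range (ι k))) atTop (𝓝 A))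
    (μ : Measure (EuclideanSpace ℝ (Fin 6))) [IsFiniteMeasure μ]
    (hsupp : μ {z : EuclideanSpace ℝ (Fin 6) | ¬ (∑ i : Fin 5, z (Fin.castSucc i) ^ 2 = 1 ∧ |z 5| ≤ B)} = 0)
    (hweak : ∀ g : EuclideanSpace ℝ (Fin 6) →ᵇ ℝ,
      Tendsto (fun k => ∫ z in range (ι k), g z ∂(μH[4] : Measure (EuclideanSpace ℝ (Fin 6)))) atTop (𝓝 (∫ z, g z ∂μ)))
    {Φ : ℝ → ℝ} (hΦ : ContDiff ℝ 2 Φ) {P : EuclideanSpace ℝ (Fin 5) → ℝ} (hP : ContDiff ℝ 2 P)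
    {F : EuclideanSpace ℝ (Fin 6) → ℝ}
    (hF : ∀ z, F z = Φ (z 5) *
      ((∑ j : Fin 5, iteratedFDeriv ℝ 2 P (truncL z)
          ![EuclideanSpace.single j (1 : ℝ), EuclideanSpace.single j (1 : ℝ)])
        - iteratedFDeriv ℝ 2 P (truncL z) ![truncL z, truncL z]
        - 4 * fderiv ℝ P (truncL z) (truncL z))) :
    ∫ z, F z ∂μ = 0 := by
  -- Mathlib's normalisation `μHE⁴ = c • μH⁴`, `c ≠ 0`
  obtain ⟨c, hc0, hc⟩ : ∃ c : ℝ≥0, c ≠ 0 ∧ (μHE[4] : Measure (EuclideanSpace ℝ (Fin 6))) = c • (μH[4] : Measure (EuclideanSpace ℝ (Fin 6))) :=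
    ⟨_, Measure.addHaarScalarFactor_volume_hausdorffMeasure_ne_zero 4,
      Measure.euclideanHausdorffMeasure_def (X := EuclideanSpace ℝ (Fin 6)) 4⟩
  have hμP : ∀ k, (c : ℝ≥0∞) • Measure.comap (ι k) (μH[4] : Measure (EuclideanSpace ℝ (Fin 6))) =
      riemannianMeasure ((euclideanMetric (EuclideanSpace ℝ (Fin 6))).inducedRiemannianMetric (ι k)
        contMDiff_pullbackBilin_holds (himm k)) :=
    fun k => smul_comap_hausdorffMeasure_eq_riemannianMeasure (himm k) (hinj k) hc
  -- the constants
  obtain ⟨A₁, hA₁, hΦb⟩ := exists_common_bound (isCompact_Icc (a := -B) (b := B)) hΦ.continuous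
    (hΦ.continuous_deriv (by norm_num)) (continuous_deriv_deriv hΦ)
  obtain ⟨A₂, hA₂, hPb⟩ := exists_common_bound (isCompact_closedBall (0 : EuclideanSpace ℝ (Fin 5)) 1) hP.continuous
    (hP.continuous_fderiv two_ne_zero) (hP.continuous_iteratedFDeriv (m := 2) le_rfl)
  -- `F` is continuous; its bounded continuous clamp
  have h5 : Continuous fun z : EuclideanSpace ℝ (Fin 6) => z 5 :=
    (EuclideanSpace.proj (5 : Fin 6) : EuclideanSpace ℝ (Fin 6) →L[ℝ] ℝ).continuous
  have hFc : Continuous F := by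
    rw [funext hF]
    exact (hΦ.continuous.comp h5).mul (((continuous_finsetSum _ fun j _ =>
      continuous_iteratedFDeriv_two_app hP truncL.continuous continuous_const continuous_const).sub
        (continuous_iteratedFDeriv_two_app hP truncL.continuous truncL.continuous
          truncL.continuous)).sub
      (continuous_const.mul (continuous_fderiv_app hP truncL.continuous truncL.continuous)))
  obtain ⟨C₀, hC₀⟩ :=
    (isCompact_closedBall (0 : EuclideanSpace ℝ (Fin 6)) (1 + |B|)).exists_bound_of_continuousOn hFc.continuousOn
  obtain ⟨C, hC, hCC⟩ : ∃ C : ℝ, 0 ≤ C ∧ C₀ ≤ C := ⟨max C₀ 0, le_max_right _ _, le_max_left _ _⟩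
  obtain ⟨gb, hgb⟩ : ∃ gb : EuclideanSpace ℝ (Fin 6) →ᵇ ℝ, ∀ z, gb z = max (-C) (min (F z) C) :=
    ⟨BoundedContinuousFunction.ofNormedAddCommGroup (fun z => max (-C) (min (F z) C))
      (continuous_const.max (hFc.min continuous_const)) C
      (fun z => by
        rw [Real.norm_eq_abs, abs_le]
        exact ⟨le_max_left _ _, max_le (by linarith) (min_le_right _ _)⟩),
      fun _ => rfl⟩
  have hgbF : ∀ z : EuclideanSpace ℝ (Fin 6), ‖z‖ ≤ 1 + |B| → gb z = F z := fun z hz => by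
    have h := (hC₀ z (mem_closedBall_zero_iff.2 hz)).trans hCC
    rw [Real.norm_eq_abs, abs_le] at h
    rw [hgb, min_eq_left h.2, max_eq_right h.1]
  -- the real sequences
  obtain ⟨I, hI⟩ : ∃ I : ℕ → ℝ, ∀ k, I k = ∫ w, F (ι k w)
      ∂riemannianMeasure ((euclideanMetric (EuclideanSpace ℝ (Fin 6))).inducedRiemannianMetric (ι k)
        contMDiff_pullbackBilin_holds (himm k)) := ⟨_, fun _ => rfl⟩
  obtain ⟨T, hT⟩ : ∃ T : ℕ → ℝ, ∀ k, T k = ∫ w, (1 - ν k w 5 ^ 2)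
      ∂riemannianMeasure ((euclideanMetric (EuclideanSpace ℝ (Fin 6))).inducedRiemannianMetric (ι k)
        contMDiff_pullbackBilin_holds (himm k)) := ⟨_, fun _ => rfl⟩
  obtain ⟨Q, hQ⟩ : ∃ Q : ℕ → ℝ, ∀ k, Q k =
      ∫ w, (euclideanMetric (EuclideanSpace ℝ (Fin 6))).meanCurvature (ι k) contMDiff_pullbackBilin_holds (himm k) (ν k) w ^ 2
      ∂riemannianMeasure ((euclideanMetric (EuclideanSpace ℝ (Fin 6))).inducedRiemannianMetric (ι k)
        contMDiff_pullbackBilin_holds (himm k)) := ⟨_, fun _ => rfl⟩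
  obtain ⟨a, ha⟩ : ∃ a : ℕ → ℝ, ∀ k, a k =
      (riemannianMeasure ((euclideanMetric (EuclideanSpace ℝ (Fin 6))).inducedRiemannianMetric (ι k)
        contMDiff_pullbackBilin_holds (himm k)) univ).toReal := ⟨_, fun _ => rfl⟩
  -- the single-slice estimates
  have hest : ∀ k, |I k| ≤ A₁ * A₂ * (3 * T k + 2 * Real.sqrt (a k * T k) + 2 * Real.sqrt (a k * Q k)) :=
    fun k => by
      rw [hI, hT, ha, hQ]
      exact abs_integral_productTest_comp_le (himm k) (hν k) (hun k) (hN k) (hνN k) (hB k) hΦ hP hA₁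
        hA₂ hΦb hPb hFc hF
  -- the decays
  have hT0 : Tendsto T atTop (𝓝 0) := by
    rw [funext hT]
    exact tendsto_integral_zero_of_tendsto_lintegral_zero hμP
      (fun k w => one_sub_sq_apply_five_nonneg (hun k) w)
      (fun k => (continuous_const.sub ((h5.comp (hν k).continuous).pow 2)).aestronglyMeasurable)
      (tendsto_lintegral_tiltExcess_comap hinj himm hν hun hN hνN hB hW hA hAr)
  have hQ0 : Tendsto Q atTop (𝓝 0) := by
    rw [funext hQ]
    exact tendsto_integral_zero_of_tendsto_lintegral_zero hμP (fun k w => sq_nonneg _)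
      (fun k => ((continuous_meanCurvature_euclidean (himm k) (hν k)).pow 2).aestronglyMeasurable) hW
  have hme : ∀ k, MeasurableEmbedding (ι k) := fun k =>
    ((himm k).contMDiff.continuous.isClosedEmbedding (hinj k)).measurableEmbedding
  have haL : Tendsto a atTop (𝓝 (((c : ℝ≥0∞) * A).toReal)) := by
    have ha' : ∀ k, a k = ((c : ℝ≥0∞) * μH[4] (range (ι k))).toReal := fun k => by
      rw [ha, ← hμP k, Measure.smul_apply, smul_eq_mul, (hme k).comap_apply, image_univ]
    rw [funext ha']
    exact (ENNReal.tendsto_toReal (ENNReal.mul_ne_top ENNReal.coe_ne_top hA.ne)).comp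
      (ENNReal.Tendsto.const_mul hAr (Or.inr ENNReal.coe_ne_top))
  -- first limit: `I k → 0`
  have hlim0 : Tendsto I atTop (𝓝 0) := by
    refine squeeze_zero_norm
      (a := fun k => A₁ * A₂ * (3 * T k + 2 * Real.sqrt (a k * T k) + 2 * Real.sqrt (a k * Q k)))
      (fun k => ?_) ?_
    · rw [Real.norm_eq_abs]
      exact hest k
    · have h := ((((hT0.const_mul 3).add (((haL.mul hT0).sqrt).const_mul 2)).add
        (((haL.mul hQ0).sqrt).const_mul 2)).const_mul (A₁ * A₂))
      simpa only [mul_zero, Real.sqrt_zero, add_zero] using h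
  -- second limit: `I k → c ∫ F dμ`
  have hmeas : ∀ k, MeasurableSet (range (ι k)) := fun k =>
    (isCompact_range (himm k).contMDiff.continuous).isClosed.measurableSet
  have hI' : ∀ k, I k = (c : ℝ) * ∫ z in range (ι k), gb z ∂(μH[4] : Measure (EuclideanSpace ℝ (Fin 6))) := fun k => by
    rw [hI, integral_comp_riemannianMeasure_induced (himm k) (hinj k) F, hc, Measure.restrict_smul,
      integral_smul_nnreal_measure, setIntegral_congr_fun (hmeas k) (fun z hz => ?_), NNReal.smul_def,
      smul_eq_mul]
    obtain ⟨w, rfl⟩ := hz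
    exact (hgbF _ (norm_le_one_add_abs (hN k w) (hB k w))).symm
  have hgbμ : ∫ z, gb z ∂μ = ∫ z, F z ∂μ := by
    refine integral_congr_ae ?_
    have hK : ∀ᵐ z ∂μ, (∑ i : Fin 5, z (Fin.castSucc i) ^ 2 = 1 ∧ |z 5| ≤ B) := ae_iff.2 hsupp
    exact hK.mono fun z hz => hgbF z (norm_le_one_add_abs hz.1 hz.2)
  have hlim1 : Tendsto I atTop (𝓝 ((c : ℝ) * ∫ z, F z ∂μ)) := by
    rw [funext hI', ← hgbμ]
    exact (hweak gb).const_mul _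
  -- uniqueness of limits
  have hzero := tendsto_nhds_unique hlim1 hlim0
  exact (mul_eq_zero.1 hzero).resolve_left (NNReal.coe_ne_zero.2 hc0)

end Limit

/-- **Registered helper `helper_productTestLimit` of line `killing-flux` (step S2 of the
area-quantization plan: the product-test identities pass to the limit).** For a sequence of closed
smooth embedded cross-sections `ι_k : M⁴ → N = S⁴ × ℝ ⊂ ℝ⁶` with smooth unit normals `ν_k` tangent to
`N`, heights `|z₅| ≤ B`, `∫ H_k² d(ι_k^*μH⁴) → 0`, areas `μH⁴(ι_k(M)) → A < ∞` and area measures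
converging weakly to a finite measure `μ` carried by the slab, for every `Φ ∈ C²(ℝ)` and
`P ∈ C²(ℝ⁵)`: `∫ Φ(z₅) [Δ_{ℝ⁵}P(z') - D²P(z')(z',z') - 4 DP(z')(z')] dμ(z) = 0` (`productTest_limit`;
the embeddings are injective, `Manifold.IsSmoothEmbedding.isEmbedding`). [cite: Allard1972, §6] -/
theorem helper_productTestLimit : ∀ (M : Type) [TopologicalSpace M] [T2Space M] [SecondCountableTopology M] [ChartedSpace (EuclideanSpace ℝ (Fin 4)) M] [IsManifold (𝓡 4) ∞ M] [CompactSpace M] [MeasurableSpace M] [BorelSpace M] (ι : ℕ → M → EuclideanSpace ℝ (Fin 6)) (ν : ℕ → M → EuclideanSpace ℝ (Fin 6)), (∀ k, Manifold.IsSmoothEmbedding (𝓡 4) (𝓡 6) ∞ (ι k)) → (∀ k x, ∑ i : Fin 5, ι k x (Fin.castSucc i) ^ 2 = 1) → ∀ himm : ∀ k, (euclideanMetric (EuclideanSpace ℝ (Fin 6))).IsSpacelikeImmersion (𝓡 4) (ι k), (∀ k, (euclideanMetric (EuclideanSpace ℝ (Fin 6))).IsUnitNormal (𝓡 4) (ι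 k) (ν k) 1) → (∀ k x, ∑ i : Fin 5, ν k x (Fin.castSucc i) * ι k x (Fin.castSucc i) = 0) → (∀ k, ContMDiff (𝓡 4) (𝓡 6) ∞ (ν k)) → ∀ B : ℝ, (∀ k x, |ι k x 5| ≤ B) → Filter.Tendsto (fun k => ∫⁻ x, ENNReal.ofReal ((euclideanMetric (EuclideanSpace ℝ (Fin 6))).meanCurvature (ι k) contMDiff_pullbackBilin_holds (himm k) (ν k) x ^ 2) ∂(Measure.comap (ι k) (μH[4] : Measure (EuclideanSpace ℝ (Fin 6))))) Filter.atTop (𝓝 0) → ∀ A : ℝ≥0∞, A < ⊤ → Filter.Tendsto (fun k => μH[4] (Set.range (ι k))) Filter.atTop (𝓝 A) → ∀ (μ : Measure (EuclideanSpace ℝ (Fin 6))) [IsFiniteMeasure μ], μ {z : EuclideanSpace ℝ (Fin 6) | ¬ (∑ i : Fin 5, z (Fin.castSucc i) ^ 2 = 1 ∧ |z 5| ≤ B)} = 0 → (∀ g : BoundedContinuousFunction (EuclideanSpace ℝ (Fin 6)) ℝ, Filter.Tendsto (fun k => ∫ z in Set.range (ι k), g z ∂(μH[4] : Measure (EuclideanSpace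 ℝ (Fin 6)))) Filter.atTop (𝓝 (∫ z, g z ∂μ))) → ∀ Φ : ℝ → ℝ, ContDiff ℝ 2 Φ → ∀ P : EuclideanSpace ℝ (Fin 5) → ℝ, ContDiff ℝ 2 P → ∫ z, Φ (z 5) * ((∑ j : Fin 5, iteratedFDeriv ℝ 2 P (truncL z) ![EuclideanSpace.single j (1 : ℝ), EuclideanSpace.single j (1 : ℝ)]) - iteratedFDeriv ℝ 2 P (truncL z) ![truncL z, truncL z] - 4 * fderiv ℝ P (truncL z) (truncL z)) ∂μ = 0 :=
  fun _ _ _ _ _ _ _ _ _ _ _ hemb hN himm hun hνN hνs _ hB hW _ hA hAr μ _ hsupp hweak _ hΦ _ hP =>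
    productTest_limit (fun k => (hemb k).isEmbedding.injective) himm hνs hun hN hνN hB hW hA hAr μ
      hsupp hweak hΦ hP (fun _ => rfl)

end Summit.SmoothPoincare4.SmoothPoincare4.Cruxes.CylinderRungTwo.KillingFlux

end
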